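import Summits.QuantumFields.BalabanUV.T4Continuum.Spine.NE3.SupRegularityCurvedUniform
import Summits.QuantumFields.BalabanUV.T4Continuum.Support.NE3AveragedGradientRadius
import HarnessLib

/-!
# T⁴ programme, node NE3 — census R39 (capstone): THE END's PER-PAIR SUP LETTER `hK` AT THE AVERAGED BACKGROUND `W = cavg L U_B`
# FROM SUP-REGULARITY OF `U_B` AND (HR_W) — the binder `hF5` of `PairLandauB8EndSfClassB8.ne3EnergyRateWCov_sfClass_B8` minus (HR_W)

Cell `pub-balaban-gaps` (YM blitz, track G2, seat `ne3`, unit `pub-balaban-gaps-ne3-g8`; writer prover-pub-balaban-gaps-ne3-g8-0, 2026-08-24), census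
`run/shared/lean/pub/pub-balaban-gaps/ne/NE3.md` §4 R39.  WHY.  The END over B8's surface (`Spine/NE3/PairLandauB8EndSfClassB8`) consumes, per pair
`(U_A, U_B)`, the sup letter `hF5 : … → LandauCorrectionSupB8 hL j hWu hx hs hWx N hθ K₀ K₁` at `W = cavg L U_B` with LEVEL-UNIFORM `K₀, K₁`
([Balaban1985BackgroundPropagators] (3.42)∕(3.48) TYPE).  Gen 7 reduced it to (H0_W) + (HR_W); gen 8 proved (H0_W) from two regularity radii of `W`
(`Spine/NE3/SupRegularityCurvedUniform`) and computed the plaquette-gradient radius of `cavg L U_B` from sup-regularity of `U_B`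
(`Support/NE3AveragedGradientRadius`).  This file COMPOSES them:

**`landauCorrectionSupB8_cavg`** — `RegularSup d L N b c (j+2) U_B` (unitary, periodic, plaquette radius `b(L^{j+2})^{−2}`, flux-gradient radius
`c(L^{j+2})^{−3}`), the block-averaging regime (Rb) `2¹⁵(d+1)²(d+4)²L²b ≤ 1`, and the two LEVEL-FREE lines `23040·d⁴(frameC+d)²·ε ≤ 1`,
`23040·d⁴(frameC+d)³·(c + curConst·b²) ≤ 1` ⟹ for the END's letters at `W = cavg L U_B` (plaquette radius `x = ε∕M²`, `M = L^{j+1}`, `θ = cruxC·ε < 1`):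
`LandauCorrectionSupB8 hL j hWu hx hs hWx N hθ K₀ K₁` ⇐ (HR_W) with constant `c_R`, where
`K₀ = d·liftC·(6 + 2(d+1)ε)·36d(frameC+d)²·c_R∕(1 − cruxC·ε)`, `K₁ = d·liftC·(6 + 2(d+1)ε)·36d(frameC+d)·c_R∕(1 − cruxC·ε)` — UNIFORM IN `j` AND `N`.
So of the END's [B9]-§3-type inputs at the averaged background only (HR_W) (the Landau-projection sup bound, proved at `W = 1` in
`Spine/NE3/LandauProjectionSupFlat`) and (P♮) remain, given [B11] Thm 1 (10)-type sup-regularity of the minimisers `U_B` (the tree's `RegularSup`, a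
hypothesis SHAPE the ENDs over `ClassSix` already carry).

HONEST: lattice analysis + kinematics of (42); nothing of Bałaban's is asserted; NE3 NOT proved; spine 0∕9; NOT continuum, NOT a mass gap, NOT Clay.
-/

set_option autoImplicit false

open scoped BigOperators Matrix Matrix.Norms.L2Operator
open NormedSpace Finset

namespace Summit.QuantumFields.BalabanUV.T4Continuum.NE3.LandauCorrectionSupB8Cavg

open Literature.MathematicalPhysics.QuantumFieldTheory.Balaban1983to89
open B7Prop1Explicit B7Prop2Explicit
open T4AveragingDeficitWall (Ad IsUnitaryCfg SmallField)
open T4AveragingDeficitWallBoundary (IsPeriodicCfg periodBox)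
open AveragingDeficitMultiLevelPrep (LevelSmall)
open AveragingDeficitChartCalculus (cavg)
open AveragingDeficitMultiLevelBridge (cavg_eq_rescale_bavg)
open MinimalActionRefine (RegularSup)
open MinimalActionLevels (isPeriodicCfg_rescale_bavg)
open BlockAverageCurrent (curConst curConst_nonneg)
open NE3QbarIterCovLiftPrep (cruxC liftC)
open NE3CovariantCalculus (hsR)
open NE3RightInverseSupLetters (frameC)
open NE3.PairLandauB8 (avgKernelGauges covLapSite)
open NE3.LandauProjectionSupShape (LandauCorrectionSupB8)
open NE3.SupRegularityCurvedUniform (landauCorrectionSupB8_uniform)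
open NE3AveragedGradientRadius (norm_plaqGrad_cavg_le_of_regularSup)

noncomputable section

variable {d : ℕ} {n : Type*} [Fintype n] [DecidableEq n]

/-- The averaged background of a `(N·L^{j+2})`-periodic configuration is `(N·L^{j+1})`-periodic. [folklore] -/
theorem isPeriodicCfg_cavg {L N j : ℕ} {U : Site d → Fin d → (Matrix n n ℂ)ˣ} (hU : IsPeriodicCfg U ((N * L ^ (j + 2) : ℕ) : ℤ)) :
    IsPeriodicCfg (cavg L U) ((N * L ^ (j + 1) : ℕ) : ℤ) := by
  rw [cavg_eq_rescale_bavg]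
  refine isPeriodicCfg_rescale_bavg L ?_
  have e : ((L : ℤ) * ((N * L ^ (j + 1) : ℕ) : ℤ)) = ((N * L ^ (j + 2) : ℕ) : ℤ) := by push_cast; ring
  rw [e]; exact hU

/-- **THE END's PER-PAIR `hK` AT `W = cavg L U_B` FROM SUP-REGULARITY OF `U_B` AND (HR_W)** (`d ≥ 1`, `L ≥ 2`, `N ≥ 1`, `j`; letters as in the binder `hF5` of
`PairLandauB8EndSfClassB8.ne3EnergyRateWCov_sfClass_B8`: `x = ε∕(L^{j+1})²`).  Level-uniform `K₀, K₁`. [folklore] -/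
theorem landauCorrectionSupB8_cavg [Nonempty n] (hd : 1 ≤ d) {L N : ℕ} [NeZero N] (hL : 2 ≤ L) (j : ℕ)
    {UB : Site d → Fin d → (Matrix n n ℂ)ˣ} {b c ε : ℝ} (hreg : RegularSup d L N b c (j + 2) UB) (hb : 0 ≤ b) (hc : 0 ≤ c)
    (hRb : 2 ^ 15 * ((d : ℝ) + 1) ^ 2 * ((d : ℝ) + 4) ^ 2 * (L : ℝ) ^ 2 * b ≤ 1)
    (hεF : 23040 * (d : ℝ) ^ 4 * (frameC d L + d) ^ 2 * ε ≤ 1)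
    (hcF : 23040 * (d : ℝ) ^ 4 * (frameC d L + d) ^ 3 * (c + curConst d L * b ^ 2) ≤ 1)
    (hWu : IsUnitaryCfg (cavg L UB)) (hx : 0 ≤ ε / ((L : ℝ) ^ (j + 1)) ^ 2) (hs : LevelSmall d L j (ε / ((L : ℝ) ^ (j + 1)) ^ 2))
    (hWx : SmallField (cavg L UB) (ε / ((L : ℝ) ^ (j + 1)) ^ 2))
    (hθ : cruxC d L * (((L : ℝ) ^ (j + 1)) ^ 2 * (ε / ((L : ℝ) ^ (j + 1)) ^ 2)) < 1) {cR : ℝ}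
    (hRW : ∀ (F : Site d → Matrix n n ℂ), (∀ y : Site d, F y ∈ skewAdjoint (Matrix n n ℂ)) →
      (∀ (y : Site d) (i : Fin d), F (y + ((N * L ^ (j + 1) : ℕ) : ℤ) • e i) = F y) →
      ∀ μ ∈ avgKernelGauges (d := d) (n := n) L N (j + 1) (cavg L UB),
        (∀ ν ∈ avgKernelGauges (d := d) (n := n) L N (j + 1) (cavg L UB),
          ∑ y ∈ periodBox (d := d) (N * L ^ (j + 1)), hsR (F y + covLapSite (cavg L UB) μ y) (covLapSite (cavg L UB) ν y) = 0) →
        ∀ B : ℝ, (∀ y : Site d, ‖F y‖ ≤ B) → ∀ y : Site d, ‖covLapSite (cavg L UB) μ y‖ ≤ cR * B) :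
    LandauCorrectionSupB8 hL j hWu hx hs hWx N hθ
      ((d : ℝ) * liftC d * (6 + 2 * ((d : ℝ) + 1) * ε) * (36 * d * (frameC d L + d) ^ 2) * cR / (1 - cruxC d L * ε))
      ((d : ℝ) * liftC d * (6 + 2 * ((d : ℝ) + 1) * ε) * (36 * d * (frameC d L + d)) * cR / (1 - cruxC d L * ε)) := by
  have hL1 : 1 ≤ L := by omega
  have hM0 : (0 : ℝ) < (L : ℝ) ^ (j + 1) := by positivity
  have hMε : ((L : ℝ) ^ (j + 1)) ^ 2 * (ε / ((L : ℝ) ^ (j + 1)) ^ 2) = ε := by field_simp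
  -- the plaquette-gradient radius of `cavg L U_B` at level `j + 1`
  set x₁ : ℝ := 2 * (c + curConst d L * b ^ 2) / ((L : ℝ) ^ (j + 1)) ^ 3 with hx₁
  have hx10 : 0 ≤ x₁ := by have := curConst_nonneg (d := d) L; positivity
  have hgrad : ∀ (p : Site d) (μ κ : Fin d), κ ≠ μ →
      ‖Ad (cavg L UB p μ) ((hol (cavg L UB) (p + e μ) (plaqWord κ μ) : (Matrix n n ℂ)ˣ) : Matrix n n ℂ)
        - ((hol (cavg L UB) p (plaqWord κ μ) : (Matrix n n ℂ)ˣ) : Matrix n n ℂ)‖ ≤ x₁ :=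
    fun p μ κ hκμ => norm_plaqGrad_cavg_le_of_regularSup (k := j + 1) hL1 hreg hb hRb p μ hκμ
  -- the two level-free lines in the letters of `SupRegularityCurvedUniform`
  have hbx : 23040 * (d : ℝ) ^ 4 * (frameC d L + d) ^ 2 * ((L : ℝ) ^ (j + 1)) ^ 2 * (ε / ((L : ℝ) ^ (j + 1)) ^ 2) ≤ 1 := by
    rw [mul_assoc (23040 * (d : ℝ) ^ 4 * (frameC d L + d) ^ 2), hMε]; exact hεF
  have hcx : 11520 * (d : ℝ) ^ 4 * (frameC d L + d) ^ 3 * ((L : ℝ) ^ (j + 1)) ^ 3 * x₁ ≤ 1 := by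
    have e1 : 11520 * (d : ℝ) ^ 4 * (frameC d L + d) ^ 3 * ((L : ℝ) ^ (j + 1)) ^ 3 * x₁
        = 23040 * (d : ℝ) ^ 4 * (frameC d L + d) ^ 3 * (c + curConst d L * b ^ 2) := by
      rw [hx₁]; field_simp; ring
    rw [e1]; exact hcF
  have hWP : IsPeriodicCfg (cavg L UB) ((N * L ^ (j + 1) : ℕ) : ℤ) := isPeriodicCfg_cavg hreg.periodic
  have h := landauCorrectionSupB8_uniform hd hL j hWu hx hs hWx N hθ hWP hx10 hgrad hbx hcx hRW
  rw [hMε] at h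
  exact h

end

end Summit.QuantumFields.BalabanUV.T4Continuum.NE3.LandauCorrectionSupB8Cavg
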